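import Literature.MathematicalPhysics.QuantumFieldTheory.Balaban1983to89.B15Norm1102Object
import Summits.QuantumFields.YangMills.Theorems.BalabanUVNodesN21ThresholdMixtureTowerOpsDenominator

/-!
# N21 (NE7c), strategy s3 «alternative currency», file 25 — FUBINI ODDS (LENS nearmiss g12 ROW H = Card 34, landed verbatim with credit): the joint-fibre
# odds bound `∫⌈_{sN∪sF} t_a ≤ ε·M·∫⌈_{sN∪sF} t_{a′}` from SUP-ODDS on the near fibre × OSCILLATION on the far fibre — 20o's `hcond` with its constant factorised

PROVENANCE AND CREDIT.  This module is the planner seat `ym-lens-BalabanUVNodes-nearmiss`'s `Sketch-nearmiss-g12.lean` §H (sha16 e6983e2e0315f640; memo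
`LENS-nearmiss.md` v12.0 sha16 0ce22440a127f1e5, Card 34; bus l.18639, FAN-OUT v12.0 ROW H «20q … natural owner dag-n21-d (feeds 20o's `hcond`), may be
folded into 20p») landed VERBATIM by seat `pub-ymgap-dag-n21-e` (g9; n21-d g6 ■ l.18789 without 20q; TAKE-M∕H l.18840); the filer's only changes: this
header and the namespace.  Imports exactly as the sketch names them: `Lit/B15Norm1102Object` (`fibreIntegral_le`, `measurable_fibreIntegral`,
`fibreIntegral_mul_of_indep`) and this seat's file 16 `…N21ThresholdMixtureTowerOpsDenominator` (`fibreIntegral_mono` :69, CITED — the lens's g12 draft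
had re-declared it letter for letter and removed it on dedup).  Lane: `--kind proof --supports stmt-QuantumFields-20296 --as helper` (K3⁵
`SpineGivenEndpointR13SepCoP`, plan g68 KEY-20 ∕ dag-lead WORDS-141).  Companion: file 24 `…N21InsertFibreShell` (ROW M).  Consumer of record: n21-d g6's
20o `…N21HistoriesRStepOnOff` (p521902 ✓), whose hypothesis `hcond` this factorises.  Count-neutral.

THE CONTENT (lens §H, Card 34).  For disjoint fibres `sN` (near: the slot block's own variables) and `sF` (far), bounded measurable terms `tA, tB, tA'`
(the (2.26)-terms of the letters `a`, `b`, `a′` of one cube): (H1) at EVERY configuration the near-fibre integral of `tA` is at most `ε ×` that of `tB`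
(the sup-odds form of the ON estimate — a statement about ONE block's fibre law, frozen exterior) and (H2) at every configuration the far-fibre integral
of `tB` is at most `M ×` that of `tA'` (the far gas's oscillation between two letters that agree near the block) ⇒ over the JOINT fibre
`∫⌈_{sN∪sF} tA ≤ ε·M·∫⌈_{sN∪sF} tA'` (★★ `fibreIntegral_union_le_of_supOdds_farOsc`; two Fubini orders — `fibreIntegral_union_eq_iterate` = Mathlib
`lmarginal_union` in `fibreIntegral` letters —, two monotone steps, two constant pull-outs).

HONEST FRAMING.  NE7c is NOT PRINTED and NOT PROVED.  [folklore] `lmarginal` bookkeeping; (H1) and (H2) are hypothesis SHAPES = exactly the unprinted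
estimates (the ON block's sup-odds at frozen exterior; the far oscillation); nothing of Bałaban's asserted; N21 NOT discharged; counts UNMOVED;
count-neutral; one finite 𝕋⁴ at fixed `ε`; NOT ℝ⁴ ∕ OS ∕ mass gap ∕ Clay.

CITATION HEADER (lean-in-tree rule 2026-08-18).  BY NAME: `B15.BasicStep.fibreIntegral` ∕ `lmarginal_ofReal_le` ∕ `ofReal_comp_measurable`; `B15Norm1102Object.fibreIntegral_le`
∕ `measurable_fibreIntegral` ∕ `fibreIntegral_mul_of_indep`; `N21ThresholdMixtureTowerOpsDenominator.fibreIntegral_mono`; Mathlib `MeasureTheory.lmarginal_union`.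
Context only (SHAPE, nothing asserted): [Balaban1989LargeFieldI] (1.100) p. 198; [Balaban1988Convergent] (2.26) p. 259 (the per-cube letters).

WHAT IS PROVED ([folklore]; lens §H).  `fibreIntegral_union_eq_iterate` · ★★ `fibreIntegral_union_le_of_supOdds_farOsc`.
-/

set_option autoImplicit false

noncomputable section

namespace Summit.QuantumFields.YangMills.Theorems.N21FibreFubiniOdds

open Literature.MathematicalPhysics.QuantumFieldTheory.Balaban1983to89

/-! ## §H  Card 34: g11's `hcond` DISSOLVED BY FUBINI — sup-odds on the near fibre × oscillation on the far fibre -/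

section FAR

open MeasureTheory
open scoped ENNReal
open Literature.MathematicalPhysics.QuantumFieldTheory.Balaban1983to89.B15.BasicStep
  (fibreIntegral lmarginal_ofReal_le ofReal_comp_measurable)
open Literature.MathematicalPhysics.QuantumFieldTheory.Balaban1983to89.B15Norm1102Object
  (fibreIntegral_le measurable_fibreIntegral fibreIntegral_mul_of_indep)
-- monotonicity of the real fibre integral: IN TREE (n21-e `…N21ThresholdMixtureTowerOpsDenominator` :69) — cited, not re-declared
open Summit.QuantumFields.YangMills.Theorems.N21ThresholdMixtureTowerOpsDenominator (fibreIntegral_mono)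

variable {P : Params} {j : ℕ} {G : Type*} [GaugeGroup G] [MeasurableSpace G] [HaarData G] [DecidableEq (PBond P j)]

/-- FUBINI for the real fibre integral over a disjoint union of fibres (bounded measurable integrand; Mathlib
`lmarginal_union` + finiteness of the inner marginal). [folklore] -/
theorem fibreIntegral_union_eq_iterate {s₁ s₂ : Finset (PBond P j)} (hd : Disjoint s₁ s₂) {g : Density P j G}
    (hg : Measurable g) {C : ℝ} (hgC : ∀ U, g U ≤ C) (V : GaugeField P j G) :
    fibreIntegral (s₁ ∪ s₂) g V = fibreIntegral s₁ (fibreIntegral s₂ g) V := by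
  unfold fibreIntegral
  have hu := lmarginal_union (fun _ : PBond P j => (HaarData.haar : Measure G))
    (fun U : GaugeField P j G => ENNReal.ofReal (g U)) (ofReal_comp_measurable hg) hd
  refine congrArg ENNReal.toReal ((congrFun hu V).trans ?_)
  refine congrFun (congrArg (fun f => ∫⋯∫⁻_s₁, f ∂(fun _ : PBond P j => (HaarData.haar : Measure G))) ?_) V
  funext W
  exact (ENNReal.ofReal_toReal (ne_top_of_le_ne_top ENNReal.ofReal_ne_top (lmarginal_ofReal_le s₂ hgC W))).symm

/-- ★★ (H) **SUP-ODDS ON THE NEAR FIBRE × OSCILLATION ON THE FAR FIBRE.**  For disjoint fibres `sN` (near: the slot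
block's own variables) and `sF` (far), bounded measurable terms `tA, tB, tA'` (the (2.26)-terms of the letters `a`, `b`,
`a′` of one cube), if (H1) at EVERY configuration the near-fibre integral of `tA` is at most `ε ×` that of `tB` (the
sup-odds form of the ON estimate — a statement about ONE block's fibre law, frozen exterior) and (H2) at every
configuration the far-fibre integral of `tB` is at most `M ×` that of `tA'` (the far gas's oscillation between two
letters that agree near the block: `M = e^{c}·(odds b : a′)`), then over the JOINT fibre `∫⌈ tA ≤ ε·M·∫⌈ tA'` — which is
g11's `hcond` with its constant factorised.  Two Fubini orders, two monotone steps, two constant pull-outs. [folklore] -/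
theorem fibreIntegral_union_le_of_supOdds_farOsc {sN sF : Finset (PBond P j)} (hd : Disjoint sN sF)
    {tA tB tA' : Density P j G} (hA : Measurable tA) (hB : Measurable tB) (hA' : Measurable tA')
    {C : ℝ} (hC0 : 0 ≤ C) (hAC : ∀ U, tA U ≤ C) (hBC : ∀ U, tB U ≤ C) (hA'C : ∀ U, tA' U ≤ C)
    {ε M : ℝ} (hε : 0 ≤ ε) (hM : 0 ≤ M)
    (H1 : ∀ W, fibreIntegral sN tA W ≤ ε * fibreIntegral sN tB W)
    (H2 : ∀ W, fibreIntegral sF tB W ≤ M * fibreIntegral sF tA' W) (V : GaugeField P j G) :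
    fibreIntegral (sN ∪ sF) tA V ≤ ε * M * fibreIntegral (sN ∪ sF) tA' V := by
  have hdc : Disjoint sF sN := hd.symm
  have e1 : fibreIntegral (sN ∪ sF) tA V = fibreIntegral sF (fibreIntegral sN tA) V := by
    rw [Finset.union_comm]; exact fibreIntegral_union_eq_iterate hdc hA hAC V
  have e2 : fibreIntegral (sN ∪ sF) tB V = fibreIntegral sF (fibreIntegral sN tB) V := by
    rw [Finset.union_comm]; exact fibreIntegral_union_eq_iterate hdc hB hBC V
  have e3 : fibreIntegral (sN ∪ sF) tB V = fibreIntegral sN (fibreIntegral sF tB) V :=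
    fibreIntegral_union_eq_iterate hd hB hBC V
  have e4 : fibreIntegral (sN ∪ sF) tA' V = fibreIntegral sN (fibreIntegral sF tA') V :=
    fibreIntegral_union_eq_iterate hd hA' hA'C V
  have m1 : fibreIntegral sF (fibreIntegral sN tA) V ≤ fibreIntegral sF (fun W => ε * fibreIntegral sN tB W) V :=
    fibreIntegral_mono sF H1 (C := ε * C)
      (fun W => mul_le_mul_of_nonneg_left (fibreIntegral_le sN hBC hC0 W) hε) V
  have p1 : fibreIntegral sF (fun W => ε * fibreIntegral sN tB W) V = ε * fibreIntegral sF (fibreIntegral sN tB) V :=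
    fibreIntegral_mul_of_indep sF (h := fun _ => ε) (fun _ _ => rfl) (fun _ => hε) (measurable_fibreIntegral sN hB) V
  have m2 : fibreIntegral sN (fibreIntegral sF tB) V ≤ fibreIntegral sN (fun W => M * fibreIntegral sF tA' W) V :=
    fibreIntegral_mono sN H2 (C := M * C)
      (fun W => mul_le_mul_of_nonneg_left (fibreIntegral_le sF hA'C hC0 W) hM) V
  have p2 : fibreIntegral sN (fun W => M * fibreIntegral sF tA' W) V = M * fibreIntegral sN (fibreIntegral sF tA') V :=
    fibreIntegral_mul_of_indep sN (h := fun _ => M) (fun _ _ => rfl) (fun _ => hM) (measurable_fibreIntegral sF hA') V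
  calc fibreIntegral (sN ∪ sF) tA V = fibreIntegral sF (fibreIntegral sN tA) V := e1
    _ ≤ ε * fibreIntegral sF (fibreIntegral sN tB) V := m1.trans_eq p1
    _ = ε * fibreIntegral sN (fibreIntegral sF tB) V := by rw [← e2, e3]
    _ ≤ ε * (M * fibreIntegral sN (fibreIntegral sF tA') V) := mul_le_mul_of_nonneg_left (m2.trans_eq p2) hε
    _ = ε * M * fibreIntegral (sN ∪ sF) tA' V := by rw [e4, mul_assoc]

end FAR

end Summit.QuantumFields.YangMills.Theorems.N21FibreFubiniOdds
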